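import Literature.IUT.LogVolume.MultiradialRegion
import HarnessLib

/-!
# The hull side of [IUTchIV] Thm. 1.10 Step (v) at the Dupuy–Hilado interface: a per-summand UPPER bound
# for `hull(U_Θ)` from per-slot containments (the `λ_min` form)

Companion to `MultiradialRegionInd1Bound.lean` (lower bounds: every slot's theta value bounds the
`v⃗`-component of `hull(U_Θ)` from below) and to abc-iut-S3's `Theorem110MinVariant.lean` (planner ruling
R2, HOME/plan/c312/STEPV-IND1-NOTE.md: the per-collection bound of Step (v) with the q-term at the LEAST
divisible slot, `collBoundMin`). Over abc-iut-c312-3's `IndPacketModel` (Dupuy–Hilado §4.7/§4.9–4.12: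
`U_Θ = Ind2(Ind1((O_𝕃(−P_Θ))^{Ind3}))`, componentwise hull), this proof-only file isolates what the text's
argument ("the union of possible images is contained in [a module]; an upper bound … may be obtained by
computing an upper bound for the log-volume of [it]", kurims p. 27–28) needs, summand by summand, once
(Ind1) ranges over all capsule permutations:

* `UThetaUnion_subset_of_slotwise` — if ONE region `W ⊆ X_{v⃗}` contains, for EVERY permutation `σ`, the
  (Ind1)-transport to `v⃗` of the (Ind3)-enlarged bare region of the permuted summand `v⃗ ∘ σ`, and `W` is
  stable under the (Ind2)-group of the summand, then the `v⃗`-component of `U_Θ` lies in `W`;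
* `hullUTheta_subset_of_slotwise` — if moreover `W` is hull-closed (an "`𝒪`-module polydisc", e.g.
  `p^{c}·(R_I)~`), the `v⃗`-component of `hull(U_Θ)` lies in `W`;
* `logμ_hullUTheta_le_of_slotwise` — hence `log μ̄_{v⃗}(hull(U_Θ)_{v⃗}) ≤ log μ̄_{v⃗}(W)` (admissibility of both).
Because `W` must absorb the transport from EVERY `σ`, in the intended instance it is the module attached
to the LEAST divisible theta value among the slots of `v⃗` (`p^{⌊λ_min − d_I − a_I⌋ − b_I}·(R_I)~`), whose
log-volume is S3's `collBoundMin`; by `MultiradialRegionInd1Bound.le_of_logμ_hullUTheta_le` no smaller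
choice can work. [cite: DupuyHilado2025, §4.11, §4.12] Nothing here takes a side on [IUTchIII] Cor. 3.12;
the containment hypotheses are exactly what the real packet model must supply ([IUTchIV] Prop. 1.2 (ii) +
(Ind3) + `d_I + a_I ≥ |I|`); typed ≠ discharged.
-/

noncomputable section

namespace Literature.IUT.LogVolume

namespace IndPacketModel

open Set
open scoped Pointwise

variable {F : Type*} [Field F] [NumberField F] (M : IndPacketModel F)
variable {lstar : ℕ} {t : M.LgpIdele lstar} (D : M.Ind3Datum t)

/-- **The `v⃗`-component of `U_Θ` from slotwise containments.** If a region `W` of the summand `v⃗`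
contains the (Ind1)-transport of the (Ind3)-enlargement `(O_𝕃(−P_Θ))^{Ind3}_{v⃗∘σ}` for EVERY permutation
`σ` of the slots, and is stable under the (Ind2)-group of the summand, then `U_Θ ∩ X_{v⃗} ⊆ W`.
[cite: DupuyHilado2025, §4.11] -/
theorem UThetaUnion_subset_of_slotwise (p j : ℕ) (e : Fin (j + 1) → placesOver F p)
    (W : Set (M.X p j e))
    (h1 : ∀ σ : Equiv.Perm (Fin (j + 1)), M.perm σ e '' D.bare3 p j (e ∘ σ) ⊆ W)
    (h2 : ∀ g : M.G₂ p j e, g • W ⊆ W) :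
    M.UThetaUnion D p j e ⊆ W := by
  intro x hx
  obtain ⟨lam, hlam⟩ := Set.mem_iUnion.mp hx
  -- `x ∈ g • (perm σ '' bare3 (e ∘ σ))` with `g = lam.1 p j e`, `σ = lam.2 j`
  change x ∈ lam.1 p j e • (M.perm (lam.2 j) e '' D.bare3 p j (e ∘ lam.2 j)) at hlam
  exact h2 (lam.1 p j e) (Set.smul_set_mono (h1 (lam.2 j)) hlam)

/-- **The `v⃗`-component of `hull(U_Θ)` from slotwise containments**: if moreover `W` is hull-closed, then
`hull(U_Θ) ∩ X_{v⃗} ⊆ W`. [cite: DupuyHilado2025, §4.11, §4.12] -/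
theorem hullUTheta_subset_of_slotwise (p j : ℕ) (e : Fin (j + 1) → placesOver F p)
    (W : Set (M.X p j e))
    (h1 : ∀ σ : Equiv.Perm (Fin (j + 1)), M.perm σ e '' D.bare3 p j (e ∘ σ) ⊆ W)
    (h2 : ∀ g : M.G₂ p j e, g • W ⊆ W) (hW : M.hullLoc p j e W = W) :
    M.hullUTheta D p j e ⊆ W := by
  have h := (M.hullLoc p j e).monotone (M.UThetaUnion_subset_of_slotwise D p j e W h1 h2)
  rw [hW] at h
  exact h

/-- **Per-summand upper bound for `−|log(Θ)|`'s `v⃗`-component**: under the slotwise containments,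
(Ind2)-stability and hull-closedness of `W`, and admissibility of both regions,
`log μ̄_{v⃗}(hull(U_Θ)_{v⃗}) ≤ log μ̄_{v⃗}(W)` — with `W` the module of the least divisible slot this is the
`λ_min` form of the Step (v) bound (S3's `collBoundMin` once `log μ̄(W)` is computed by [IUTchIV]
Prop. 1.4 (iii)). [cite: DupuyHilado2025, §4.11, §4.12] -/
theorem logμ_hullUTheta_le_of_slotwise (p j : ℕ) (e : Fin (j + 1) → placesOver F p)
    (W : Set (M.X p j e))
    (h1 : ∀ σ : Equiv.Perm (Fin (j + 1)), M.perm σ e '' D.bare3 p j (e ∘ σ) ⊆ W)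
    (h2 : ∀ g : M.G₂ p j e, g • W ⊆ W) (hW : M.hullLoc p j e W = W)
    (hH : M.adm (M.hullUTheta D p j e)) (hWadm : M.adm W) :
    M.logμ (M.hullUTheta D p j e) ≤ M.logμ W :=
  M.logμ_mono hH hWadm (M.hullUTheta_subset_of_slotwise D p j e W h1 h2 hW)

/-- The constraint on ANY slotwise container (degree `j = i+1`): a region `W` containing the
(Ind1)-transports of the (Ind3)-enlargements from every permuted summand already contains the bare
twists of EVERY slot, so (if admissible) `ln|t_{j,v⃗(k)}|_p ≤ log μ̄_{v⃗}(W)` for all slots `k` — `W` is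
at least as large as the module of the LEAST divisible theta value in the collection (the `λ_min`
constraint; compare `MultiradialRegionInd1Bound.le_of_logμ_hullUTheta_le`).
[cite: DupuyHilado2025, §4.11, §4.12] -/
theorem lnAbs_le_logμ_of_slotwise (p : ℕ) (i : Fin lstar) (e : Fin ((i : ℕ) + 1 + 1) → placesOver F p)
    (W : Set (M.X p ((i : ℕ) + 1) e))
    (h1 : ∀ σ : Equiv.Perm (Fin ((i : ℕ) + 1 + 1)),
      M.perm σ e '' D.bare3 p ((i : ℕ) + 1) (e ∘ σ) ⊆ W)
    (hWadm : M.adm W) (k : Fin ((i : ℕ) + 1 + 1)) :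
    M.lnAbs (t i p (e k)) ≤ M.logμ W := by
  -- the transported bare region of `e ∘ swap k last` lies in `W` and has log-measure `ln|t_{j, e k}|_p`
  set σ : Equiv.Perm (Fin ((i : ℕ) + 1 + 1)) := Equiv.swap k (Fin.last _) with hσ
  have hsub : M.perm σ e '' M.region t p ((i : ℕ) + 1) (e ∘ σ) ⊆ W :=
    (Set.image_mono (D.region_subset p _ (e ∘ σ))).trans (h1 σ)
  have hvol : M.logμ (M.perm σ e '' M.region t p ((i : ℕ) + 1) (e ∘ σ)) = M.lnAbs (t i p (e k)) := by
    rw [M.logμ_perm σ e (M.region_adm t p _ (e ∘ σ)), M.region_succ t i p (e ∘ σ)]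
    have : (e ∘ σ) (Fin.last _) = e k := by
      simp only [Function.comp_apply, hσ, Equiv.swap_apply_right]
    rw [M.logμ_peel_O, this]
  rw [← hvol]
  exact M.logμ_mono (M.perm_adm σ e (M.region_adm t p _ (e ∘ σ))) hWadm hsub

/-! ### The two-region form (the shape of the text's argument: a φ-stable lattice multiple inside a hull-closed module) -/

/-- **Two-region form of the slotwise bound.** In [IUTchIV] Step (v) the (Ind2)-stable region is a
multiple `L = p^{c}·log_p(R_I^×)` of the log-shell LATTICE (stable under every lattice automorphism,
Prop. 1.2 (ii) first inclusion), which is NOT hull-closed, and the volume is read on a hull-closed module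
`W = p^{c−b_I}·(R_I)~ ⊇ L` (second inclusion). So: if `L` contains the (Ind1)-transport of the
(Ind3)-enlargement from every permuted summand and is (Ind2)-stable, and `L ⊆ W` with `W` hull-closed,
then `hull(U_Θ) ∩ X_{v⃗} ⊆ W`. [cite: DupuyHilado2025, §4.11, §4.12] -/
theorem hullUTheta_subset_of_slotwise₂ (p j : ℕ) (e : Fin (j + 1) → placesOver F p)
    (L W : Set (M.X p j e))
    (h1 : ∀ σ : Equiv.Perm (Fin (j + 1)), M.perm σ e '' D.bare3 p j (e ∘ σ) ⊆ L)
    (h2 : ∀ g : M.G₂ p j e, g • L ⊆ L) (hLW : L ⊆ W) (hW : M.hullLoc p j e W = W) :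
    M.hullUTheta D p j e ⊆ W := by
  have h := (M.hullLoc p j e).monotone ((M.UThetaUnion_subset_of_slotwise D p j e L h1 h2).trans hLW)
  rw [hW] at h
  exact h

/-- … hence `log μ̄_{v⃗}(hull(U_Θ)_{v⃗}) ≤ log μ̄_{v⃗}(W)` — with `W = p^{⌊λ_min − d_I − a_I⌋ − b_I}·(R_I)~` and
[IUTchIV] Prop. 1.4 (iii) for `log μ̄(W)` this is the `λ_min` per-collection bound (abc-iut-S3's
`collBoundMin`, `Theorem110MinVariant.lean`). [cite: DupuyHilado2025, §4.11, §4.12] -/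
theorem logμ_hullUTheta_le_of_slotwise₂ (p j : ℕ) (e : Fin (j + 1) → placesOver F p)
    (L W : Set (M.X p j e))
    (h1 : ∀ σ : Equiv.Perm (Fin (j + 1)), M.perm σ e '' D.bare3 p j (e ∘ σ) ⊆ L)
    (h2 : ∀ g : M.G₂ p j e, g • L ⊆ L) (hLW : L ⊆ W) (hW : M.hullLoc p j e W = W)
    (hH : M.adm (M.hullUTheta D p j e)) (hWadm : M.adm W) :
    M.logμ (M.hullUTheta D p j e) ≤ M.logμ W :=
  M.logμ_mono hH hWadm (M.hullUTheta_subset_of_slotwise₂ D p j e L W h1 h2 hLW hW)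

end IndPacketModel

end Literature.IUT.LogVolume

end
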